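import Summits.KontsevichZagierPeriods.KontsevichZagierPeriods.Theses.HyperbolicBloch
import Literature.NumberTheory.Transcendental.KZIdealTetrahedron

/-!
# `FiveTermTransfer` (stmt-KontsevichZagierPeriods-3469) — negative knowledge, part 1: vocabulary and load-bearing hypotheses

Support file for the crux `HyperbolicBloch.FiveTermTransfer` (cdisprove seat, gen 2; work file
`Cruxes/FiveTermTransfer/Disproof.lean`). Contents: the five-term element `fiveTerm`, the signed
class map `signedClass` forced by hypothesis `hB`, the `ρ`-link `IsStandardOn` forced by `hρ`
(with `T := idealTetrahedron`), the standard choice `stdRep` built on the tree's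
`KZ.idealTetrahedronRep` (so the crux is NOT vacuous in `ρ`), the unfolding
`fiveTermTransfer_iff`, evaluation tools (`KZ.relations ≤ ker eval` is proved in the tree), and the
DECORATIVE instances: `x = 1` and `x = y` give the element `0`, `y = 1` gives the inversion element
`[ρ x] − [ρ (conj x⁻¹)]`.

LOAD-BEARING HYPOTHESES: each `FiveTermTransferWithout<H>` is the crux VERBATIM with the single
hypothesis `<H>` deleted, and each is FALSE: `x ≠ 0` (witness `(0, 1+i)`), `y ≠ 0` (witness
`((1+2i)/2, 0)`), the `ρ`-link `hρ` (constant family, witness `(i, 2+i)`), the pinning `hB`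
(constant `B`). Every refutation is by evaluation (`KZ.relations ≤ ker eval`), so any proof of the
crux must use each of these hypotheses. Parts 2–3 (`Algebraicity`, `Strengthenings`) treat the two
algebraicity hypotheses and three natural strengthenings. [cite: Neumann1998, §2 eq. (2.3)]
-/

noncomputable section

open Complex MeasureTheory Set
open scoped ComplexConjugate

namespace Summit.KontsevichZagierPeriods.HyperbolicBloch.FiveTermTransferNegative

open Literature.NumberTheory.Transcendental
open Literature.NumberTheory.Transcendental.KZ
open Summit.KontsevichZagierPeriods.KontsevichZagierPeriods.Theses.HyperbolicBloch (FiveTermTransfer)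

/-! ## §1 Vocabulary, unfolding, non-vacuity -/

/-- The five-term element of the crux, for a class map `B : ℂ → FormalRep`. [cite: Neumann1998, §2 eq. (2.3)] -/
def fiveTerm (B : ℂ → FormalRep) (x y : ℂ) : FormalRep :=
  B x - B y + B (y / x) - B ((1 - x⁻¹) / (1 - y⁻¹)) + B ((1 - x) / (1 - y))

/-- The signed class map forced by hypothesis `hB` of the crux: `[ρ z]` on the upper half plane,
`−[ρ z̄]` on the lower half plane, `0` on the real line. [cite: Neumann1998, §2 (orientation convention)] -/
def signedClass (ρ : ℂ → IntegralRep 3) (z : ℂ) : FormalRep :=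
  if 0 < z.im then KZ.of (ρ z) else if z.im < 0 then -KZ.of (ρ (conj z)) else 0

/-- The `ρ`-link `hρ` of the crux with `T := idealTetrahedron`: on the algebraic upper half plane
`ρ z` is a representation `[T(z), t⁻³]`. [folklore] -/
def IsStandardOn (ρ : ℂ → IntegralRep 3) : Prop :=
  ∀ z, IsAlgebraic ℚ z → 0 < z.im →
    (ρ z).domain = idealTetrahedron z ∧ EqOn (ρ z).integrand (fun p => 1 / p 2 ^ 3) (idealTetrahedron z)

/-- The standard choice of `ρ`: the tree's `KZ.idealTetrahedronRep` on the algebraic upper half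
plane and an arbitrary junk family `J` elsewhere (the crux does not constrain `ρ` there). [folklore] -/
def stdRep (J : ℂ → IntegralRep 3) (z : ℂ) : IntegralRep 3 :=
  open scoped Classical in
  if h : IsAlgebraic ℚ z ∧ 0 < z.im then idealTetrahedronRep z h.1 h.2 else J z

/-- Auxiliary: `stdRep_of_pos`. [folklore] -/
theorem stdRep_of_pos (J : ℂ → IntegralRep 3) {z : ℂ} (hz : IsAlgebraic ℚ z) (him : 0 < z.im) :
    stdRep J z = idealTetrahedronRep z hz him := by
  unfold stdRep
  rw [dif_pos ⟨hz, him⟩]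

/-- Auxiliary: `stdRep_of_not`. [folklore] -/
theorem stdRep_of_not (J : ℂ → IntegralRep 3) {z : ℂ} (hz : ¬ (IsAlgebraic ℚ z ∧ 0 < z.im)) :
    stdRep J z = J z := by
  unfold stdRep
  rw [dif_neg hz]

/-- `stdRep J` satisfies the `ρ`-link: the crux is not vacuous in `ρ`. [folklore] -/
theorem isStandardOn_stdRep (J : ℂ → IntegralRep 3) : IsStandardOn (stdRep J) := by
  intro z hz him
  rw [stdRep_of_pos J hz him]
  exact ⟨rfl, fun _ _ => rfl⟩

/-- **The crux, unfolded.** `T` and `B` are pinned by their hypotheses; the statement is a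
statement about all standard choices `ρ`. [folklore] -/
theorem fiveTermTransfer_iff :
    FiveTermTransfer ↔ ∀ ρ : ℂ → IntegralRep 3, IsStandardOn ρ → ∀ x y : ℂ,
      IsAlgebraic ℚ x → IsAlgebraic ℚ y → x ≠ 0 → x ≠ 1 → y ≠ 0 → y ≠ 1 → x ≠ y →
        fiveTerm (signedClass ρ) x y ∈ relations := by
  constructor
  · intro h ρ hρ x y hx hy hx0 hx1 hy0 hy1 hxy
    exact h idealTetrahedron (fun _ => rfl) ρ hρ (signedClass ρ) (fun _ => rfl) x y hx hy hx0 hx1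
      hy0 hy1 hxy
  · intro h T hT ρ hρ B hB x y hx hy hx0 hx1 hy0 hy1 hxy
    have hT' : T = idealTetrahedron := funext fun z => hT z
    subst hT'
    have hB' : B = signedClass ρ := funext fun z => hB z
    subst hB'
    exact h ρ hρ x y hx hy hx0 hx1 hy0 hy1 hxy

/-! ### Evaluation tools -/

/-- Auxiliary: `not_mem_relations_of_eval_ne_zero`. [folklore] -/
theorem not_mem_relations_of_eval_ne_zero {c : FormalRep} (h : eval c ≠ 0) : c ∉ relations :=
  fun hc => h (relations_le_ker_eval_holds hc)

/-- Auxiliary: `signedClass_of_im_pos`. [folklore] -/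
theorem signedClass_of_im_pos (ρ : ℂ → IntegralRep 3) {z : ℂ} (h : 0 < z.im) :
    signedClass ρ z = KZ.of (ρ z) := by
  simp [signedClass, h]

/-- Auxiliary: `signedClass_of_im_neg`. [folklore] -/
theorem signedClass_of_im_neg (ρ : ℂ → IntegralRep 3) {z : ℂ} (h : z.im < 0) :
    signedClass ρ z = -KZ.of (ρ (conj z)) := by
  simp [signedClass, h, not_lt.mpr h.le]

/-- Auxiliary: `signedClass_of_im_zero`. [folklore] -/
theorem signedClass_of_im_zero (ρ : ℂ → IntegralRep 3) {z : ℂ} (h : z.im = 0) :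
    signedClass ρ z = 0 := by
  simp [signedClass, h]

/-! ### Algebraic points -/

/-- Gaussian rationals are algebraic. [folklore] -/
theorem isAlgebraic_of_eq_rat (a b : ℚ) {z : ℂ} (h : z = (a : ℂ) + (b : ℂ) * I) : IsAlgebraic ℚ z := by
  have hI : IsAlgebraic ℚ I :=
    ⟨Polynomial.X ^ 2 + 1, Polynomial.Monic.ne_zero (by monicity!), by simp⟩
  rw [h]
  exact (isAlgebraic_algebraMap (R := ℚ) (A := ℂ) a).add
    ((isAlgebraic_algebraMap (R := ℚ) (A := ℂ) b).mul hI)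

/-- The reference representation `R₀ = [T(i), t⁻³]` (value `= D(i) =` Catalan's constant `> 0`). -/
def R₀ : IntegralRep 3 := idealTetrahedronRep I (isAlgebraic_of_eq_rat 0 1 (by push_cast; ring)) (by simp)

/-- Auxiliary: `R₀_value_pos`. [folklore] -/
theorem R₀_value_pos : 0 < R₀.value := value_idealTetrahedronRep_pos _ _ _

/-- With the constant junk `J = R₀`, every `stdRep` value is positive. -/
theorem value_stdRep_const_pos (z : ℂ) : 0 < (stdRep (fun _ => R₀) z).value := by
  by_cases h : IsAlgebraic ℚ z ∧ 0 < z.im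
  · rw [stdRep_of_pos _ h.1 h.2]
    exact value_idealTetrahedronRep_pos _ _ _
  · rw [stdRep_of_not _ h]
    exact R₀_value_pos

/-! ## §3 Decorative hypotheses: the instances `x = 1`, `x = y`, `y = 1` -/

/-- The instance `x = 1` of the five-term element is literally `0` (`B 1 = B 0 = 0`), so the
hypothesis `x ≠ 1` is decoration. [folklore] -/
theorem fiveTerm_one_left (ρ : ℂ → IntegralRep 3) (y : ℂ) : fiveTerm (signedClass ρ) 1 y = 0 := by
  simp [fiveTerm, signedClass_of_im_zero]

/-- The instance `x = y` of the five-term element is literally `0`, so `x ≠ y` is decoration. [folklore] -/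
theorem fiveTerm_self (ρ : ℂ → IntegralRep 3) (x : ℂ) : fiveTerm (signedClass ρ) x x = 0 := by
  unfold fiveTerm
  have h1 : signedClass ρ (x / x) = 0 := by
    rcases eq_or_ne x 0 with rfl | hx
    · simp [signedClass_of_im_zero]
    · simp [div_self hx, signedClass_of_im_zero]
  have h2 : signedClass ρ ((1 - x⁻¹) / (1 - x⁻¹)) = 0 := by
    rcases eq_or_ne (1 - x⁻¹) 0 with h | h
    · simp [h, signedClass_of_im_zero]
    · simp [div_self h, signedClass_of_im_zero]
  have h3 : signedClass ρ ((1 - x) / (1 - x)) = 0 := by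
    rcases eq_or_ne (1 - x) 0 with h | h
    · simp [h, signedClass_of_im_zero]
    · simp [div_self h, signedClass_of_im_zero]
  rw [h1, h2, h3]
  abel

/-- The instance `y = 1` of the five-term element is `B x + B x⁻¹`, i.e. for `Im x > 0` the
inversion element `[ρ x] − [ρ (1/x̄)]` (`conj x⁻¹ = 1/x̄`), which is ONE change-of-variables move
(inversion in the unit sphere; gen-1 evidence `Inversion.lean`). So `y ≠ 1` is removable too. [folklore] -/
theorem fiveTerm_one_right (ρ : ℂ → IntegralRep 3) (x : ℂ) :
    fiveTerm (signedClass ρ) x 1 = signedClass ρ x + signedClass ρ x⁻¹ := by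
  simp [fiveTerm, signedClass_of_im_zero]

/-- Auxiliary: `fiveTerm_one_right_of_im_pos`. [folklore] -/
theorem fiveTerm_one_right_of_im_pos (ρ : ℂ → IntegralRep 3) {x : ℂ} (hx : 0 < x.im) :
    fiveTerm (signedClass ρ) x 1 = KZ.of (ρ x) - KZ.of (ρ (conj x⁻¹)) := by
  have hx' : (x⁻¹).im < 0 := by
    rw [Complex.inv_im]
    have h0 : 0 < Complex.normSq x := Complex.normSq_pos.mpr (by rintro rfl; simp at hx)
    exact div_neg_of_neg_of_pos (neg_neg_of_pos hx) h0
  rw [fiveTerm_one_right, signedClass_of_im_pos ρ hx, signedClass_of_im_neg ρ hx', sub_eq_add_neg]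


/-- The standard `ρ` with the constant positive junk `R₀` off the algebraic upper half plane. -/
abbrev ρ₀ : ℂ → IntegralRep 3 := stdRep fun _ => R₀

/-- Auxiliary: `isStandardOn_ρ₀`. [folklore] -/
theorem isStandardOn_ρ₀ : IsStandardOn ρ₀ := isStandardOn_stdRep _

/-- Auxiliary: `value_ρ₀_pos`. [folklore] -/
theorem value_ρ₀_pos (z : ℂ) : 0 < (ρ₀ z).value := value_stdRep_const_pos z

/-! ## §2 Load-bearing hypotheses — `_false_without_` theorems

Each `FiveTermTransferWithout<H>` below is the crux VERBATIM with the single hypothesis `<H>`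
deleted; each is refuted by exhibiting data satisfying the remaining hypotheses for which the
five-term element has non-zero value (`KZ.relations ≤ ker eval`). So any proof must use `<H>`. -/


/-- The crux with the hypothesis `x ≠ 0` deleted. -/
def FiveTermTransferWithoutX0 : Prop :=
  ∀ (T : ℂ → Set (Fin 3 → ℝ)), (∀ z, T z = {p | 0 < p 1 ∧ z.re * p 1 < z.im * p 0 ∧ z.im * (p 0 - 1) < (z.re - 1) * p 1 ∧ 0 < p 2 ∧ 0 < z.im * (p 0 ^ 2 + p 1 ^ 2 + p 2 ^ 2 - p 0) + (z.re - Complex.normSq z) * p 1}) →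
    ∀ (ρ : ℂ → IntegralRep 3), (∀ z, IsAlgebraic ℚ z → 0 < z.im → (ρ z).domain = T z ∧ Set.EqOn (ρ z).integrand (fun p => 1 / p 2 ^ 3) (T z)) →
    ∀ (B : ℂ → FormalRep), (∀ z, B z = if 0 < z.im then KZ.of (ρ z) else if z.im < 0 then -KZ.of (ρ ((starRingEnd ℂ) z)) else 0) →
    ∀ x y : ℂ, IsAlgebraic ℚ x → IsAlgebraic ℚ y → x ≠ 1 → y ≠ 0 → y ≠ 1 → x ≠ y →
    B x - B y + B (y / x) - B ((1 - x⁻¹) / (1 - y⁻¹)) + B ((1 - x) / (1 - y)) ∈ relations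

/-- **`x ≠ 0` is load-bearing.** Witness `(x, y) = (0, 1 + i)`: with Lean's `0⁻¹ = 0`, `w / 0 = 0`
the element collapses to `[ρ i]`, of value `vol T(i) > 0`. [folklore] -/
theorem fiveTermTransfer_false_without_x0 : ¬ FiveTermTransferWithoutX0 := by
  intro h
  have hy : IsAlgebraic ℚ (1 + I) := isAlgebraic_of_eq_rat 1 1 (by push_cast; ring)
  have hmem := h idealTetrahedron (fun _ => rfl) ρ₀ isStandardOn_ρ₀ (signedClass ρ₀) (fun _ => rfl)
    0 (1 + I) isAlgebraic_zero hy zero_ne_one (by intro e; simpa using congrArg Complex.im e)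
    (by intro e; simpa using congrArg Complex.im e) (by intro e; simpa using congrArg Complex.im e)
  change fiveTerm (signedClass ρ₀) 0 (1 + I) ∈ relations at hmem
  have e4 : (1 - (0:ℂ)⁻¹) / (1 - (1 + I)⁻¹) = 1 - I := by
    apply Complex.ext <;> simp [Complex.normSq_apply] <;> norm_num
  have e5 : (1 - (0:ℂ)) / (1 - (1 + I)) = I := by
    apply Complex.ext <;> simp
  have hconj : conj (1 - I) = 1 + I := by apply Complex.ext <;> simp
  have key : fiveTerm (signedClass ρ₀) 0 (1 + I) = KZ.of (ρ₀ I) := by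
    unfold fiveTerm
    rw [div_zero, e4, e5, signedClass_of_im_zero ρ₀ (z := 0) (by simp),
      signedClass_of_im_pos ρ₀ (z := 1 + I) (by simp), signedClass_of_im_neg ρ₀ (z := 1 - I) (by simp),
      hconj, signedClass_of_im_pos ρ₀ (z := I) (by simp)]
    abel
  refine not_mem_relations_of_eval_ne_zero ?_ hmem
  rw [key, eval_of]
  exact (value_ρ₀_pos I).ne'

/-- The crux with the hypothesis `y ≠ 0` deleted. -/
def FiveTermTransferWithoutY0 : Prop :=
  ∀ (T : ℂ → Set (Fin 3 → ℝ)), (∀ z, T z = {p | 0 < p 1 ∧ z.re * p 1 < z.im * p 0 ∧ z.im * (p 0 - 1) < (z.re - 1) * p 1 ∧ 0 < p 2 ∧ 0 < z.im * (p 0 ^ 2 + p 1 ^ 2 + p 2 ^ 2 - p 0) + (z.re - Complex.normSq z) * p 1}) →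
    ∀ (ρ : ℂ → IntegralRep 3), (∀ z, IsAlgebraic ℚ z → 0 < z.im → (ρ z).domain = T z ∧ Set.EqOn (ρ z).integrand (fun p => 1 / p 2 ^ 3) (T z)) →
    ∀ (B : ℂ → FormalRep), (∀ z, B z = if 0 < z.im then KZ.of (ρ z) else if z.im < 0 then -KZ.of (ρ ((starRingEnd ℂ) z)) else 0) →
    ∀ x y : ℂ, IsAlgebraic ℚ x → IsAlgebraic ℚ y →
    x ≠ 0 → x ≠ 1 → y ≠ 1 → x ≠ y →
    B x - B y + B (y / x) - B ((1 - x⁻¹) / (1 - y⁻¹)) + B ((1 - x) / (1 - y)) ∈ relations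

/-- **`y ≠ 0` is load-bearing.** Witness `(x, y) = ((1 + 2i)/2, 0)` (chosen with `Re x = 1/2` so
that `conj (1 - x) = x`): the element collapses to `−[ρ ((3 + 4i)/5)]`, of negative value. [folklore] -/
theorem fiveTermTransfer_false_without_y0 : ¬ FiveTermTransferWithoutY0 := by
  intro h
  have hx : IsAlgebraic ℚ ((1 + 2 * I) / 2) := isAlgebraic_of_eq_rat (1 / 2) 1 (by push_cast; ring)
  have hmem := h idealTetrahedron (fun _ => rfl) ρ₀ isStandardOn_ρ₀ (signedClass ρ₀) (fun _ => rfl)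
    ((1 + 2 * I) / 2) 0 hx isAlgebraic_zero (by intro e; simpa using congrArg Complex.im e)
    (by intro e; simpa using congrArg Complex.im e) zero_ne_one
    (by intro e; simpa using congrArg Complex.im e)
  change fiveTerm (signedClass ρ₀) ((1 + 2 * I) / 2) 0 ∈ relations at hmem
  have e4 : (1 - ((1 + 2 * I) / 2)⁻¹) / (1 - (0:ℂ)⁻¹) = (3 + 4 * I) / 5 := by
    apply Complex.ext <;> simp [Complex.div_re, Complex.div_im, Complex.normSq_apply] <;> norm_num
  have e5 : (1 - (1 + 2 * I) / 2) / (1 - (0:ℂ)) = (1 - 2 * I) / 2 := by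
    rw [sub_zero, div_one]; ring
  have hconj : conj ((1 - 2 * I) / 2) = (1 + 2 * I) / 2 :=
    Complex.ext (by rw [Complex.conj_re]; norm_num) (by rw [Complex.conj_im]; norm_num)
  have key : fiveTerm (signedClass ρ₀) ((1 + 2 * I) / 2) 0 = -KZ.of (ρ₀ ((3 + 4 * I) / 5)) := by
    unfold fiveTerm
    rw [zero_div, e4, e5, signedClass_of_im_zero ρ₀ (z := 0) (by norm_num),
      signedClass_of_im_pos ρ₀ (z := (1 + 2 * I) / 2) (by norm_num),
      signedClass_of_im_pos ρ₀ (z := (3 + 4 * I) / 5) (by norm_num),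
      signedClass_of_im_neg ρ₀ (z := (1 - 2 * I) / 2) (by norm_num), hconj]
    abel
  refine not_mem_relations_of_eval_ne_zero ?_ hmem
  rw [key, map_neg, eval_of, neg_ne_zero]
  exact (value_ρ₀_pos _).ne'

/-- The constant family `ρ ≡ R₀` (violates the `ρ`-link, used when `hρ` is deleted). -/
def ρc : ℂ → IntegralRep 3 := fun _ => R₀

/-- Auxiliary: `ρc_apply`. [folklore] -/
@[simp] theorem ρc_apply (z : ℂ) : ρc z = R₀ := rfl

/-- The crux with the `ρ`-link `hρ` deleted (`ρ` arbitrary). -/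
def FiveTermTransferWithoutRhoLink : Prop :=
  ∀ (T : ℂ → Set (Fin 3 → ℝ)), (∀ z, T z = {p | 0 < p 1 ∧ z.re * p 1 < z.im * p 0 ∧ z.im * (p 0 - 1) < (z.re - 1) * p 1 ∧ 0 < p 2 ∧ 0 < z.im * (p 0 ^ 2 + p 1 ^ 2 + p 2 ^ 2 - p 0) + (z.re - Complex.normSq z) * p 1}) →
    ∀ (ρ : ℂ → IntegralRep 3), ∀ (B : ℂ → FormalRep), (∀ z, B z = if 0 < z.im then KZ.of (ρ z) else if z.im < 0 then -KZ.of (ρ ((starRingEnd ℂ) z)) else 0) →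
    ∀ x y : ℂ, IsAlgebraic ℚ x → IsAlgebraic ℚ y →
    x ≠ 0 → x ≠ 1 → y ≠ 0 → y ≠ 1 → x ≠ y →
    B x - B y + B (y / x) - B ((1 - x⁻¹) / (1 - y⁻¹)) + B ((1 - x) / (1 - y)) ∈ relations

/-- **The `ρ`-link is load-bearing.** With the constant family `ρ ≡ R₀` and the witness
`(x, y) = (i, 2 + i)` (a generic bipyramid configuration: signs `(+,+,−,+,+)`), the element is
`−[R₀]`. [folklore] -/
theorem fiveTermTransfer_false_without_rhoLink : ¬ FiveTermTransferWithoutRhoLink := by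
  intro h
  have hy : IsAlgebraic ℚ (2 + I) := isAlgebraic_of_eq_rat 2 1 (by push_cast; ring)
  have hmem := h idealTetrahedron (fun _ => rfl) ρc (signedClass ρc) (fun _ => rfl) I (2 + I)
    (isAlgebraic_of_eq_rat 0 1 (by push_cast; ring)) hy I_ne_zero (by intro e; simpa using congrArg Complex.im e)
    (by intro e; simpa using congrArg Complex.im e) (by intro e; simpa using congrArg Complex.im e)
    (by intro e; simpa using congrArg Complex.re e)
  change fiveTerm (signedClass ρc) I (2 + I) ∈ relations at hmem
  have e3 : (2 + I) / I = 1 - 2 * I := by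
    apply Complex.ext <;> simp
  have e4 : (1 - I⁻¹) / (1 - (2 + I)⁻¹) = 2 + I := by
    apply Complex.ext <;> simp [Complex.div_re, Complex.div_im, Complex.normSq_apply] <;> norm_num
  have e5 : (1 - I) / (1 - (2 + I)) = I := by
    apply Complex.ext <;> simp [Complex.div_re, Complex.div_im, Complex.normSq_apply] <;> norm_num
  have key : fiveTerm (signedClass ρc) I (2 + I) = -KZ.of R₀ := by
    unfold fiveTerm
    rw [e3, e4, e5, signedClass_of_im_pos ρc (z := I) (by norm_num),
      signedClass_of_im_pos ρc (z := 2 + I) (by norm_num),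
      signedClass_of_im_neg ρc (z := 1 - 2 * I) (by norm_num)]
    simp only [ρc_apply]
    abel
  refine not_mem_relations_of_eval_ne_zero ?_ hmem
  rw [key, map_neg, eval_of, neg_ne_zero]
  exact R₀_value_pos.ne'

/-- The crux with the pinning `hB` of `B` deleted (`B` arbitrary). -/
def FiveTermTransferWithoutHB : Prop :=
  ∀ (T : ℂ → Set (Fin 3 → ℝ)), (∀ z, T z = {p | 0 < p 1 ∧ z.re * p 1 < z.im * p 0 ∧ z.im * (p 0 - 1) < (z.re - 1) * p 1 ∧ 0 < p 2 ∧ 0 < z.im * (p 0 ^ 2 + p 1 ^ 2 + p 2 ^ 2 - p 0) + (z.re - Complex.normSq z) * p 1}) →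
    ∀ (ρ : ℂ → IntegralRep 3), (∀ z, IsAlgebraic ℚ z → 0 < z.im → (ρ z).domain = T z ∧ Set.EqOn (ρ z).integrand (fun p => 1 / p 2 ^ 3) (T z)) →
    ∀ (B : ℂ → FormalRep), ∀ x y : ℂ, IsAlgebraic ℚ x → IsAlgebraic ℚ y →
    x ≠ 0 → x ≠ 1 → y ≠ 0 → y ≠ 1 → x ≠ y →
    B x - B y + B (y / x) - B ((1 - x⁻¹) / (1 - y⁻¹)) + B ((1 - x) / (1 - y)) ∈ relations

/-- **`hB` is load-bearing** (trivially): with `B ≡ [R₀]` the element is `[R₀]`. [folklore] -/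
theorem fiveTermTransfer_false_without_hB : ¬ FiveTermTransferWithoutHB := by
  intro h
  have hy : IsAlgebraic ℚ (2 * I) := isAlgebraic_of_eq_rat 0 2 (by push_cast; ring)
  have hmem := h idealTetrahedron (fun _ => rfl) ρ₀ isStandardOn_ρ₀ (fun _ => KZ.of R₀) I (2 * I)
    (isAlgebraic_of_eq_rat 0 1 (by push_cast; ring)) hy I_ne_zero (by intro e; simpa using congrArg Complex.im e)
    (by intro e; simpa using congrArg Complex.im e) (by intro e; simpa using congrArg Complex.im e)
    (by intro e; simpa using congrArg Complex.im e)
  have key : KZ.of R₀ - KZ.of R₀ + KZ.of R₀ - KZ.of R₀ + KZ.of R₀ = KZ.of R₀ := by abel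
  rw [key] at hmem
  exact not_mem_relations_of_eval_ne_zero (by rw [eval_of]; exact R₀_value_pos.ne') hmem

end Summit.KontsevichZagierPeriods.HyperbolicBloch.FiveTermTransferNegative
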